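import Summits.BirchSwinnertonDyer.BirchSwinnertonDyer.Theorems.SignedLowerHalvesSprungLowerDivisibilityAtThreeKatoSporadicLedger
import Summits.BirchSwinnertonDyer.BirchSwinnertonDyer.Theorems.SignedLowerHalvesSprungLowerDivisibilityAtThreeStubPeriodMu
import Literature.NumberTheory.EllipticCurves.Sprung2012.SharpFlatKatoDivisibility
import Literature.NumberTheory.EllipticCurves.Sprung2012.SharpFlatSelmerDualExistsProofs
import Literature.NumberTheory.EllipticCurves.Sprung2012.SharpFlatColemanKatoZetaJoint
import Literature.NumberTheory.EllipticCurves.Sprung2017.SharpFlatNonvanishingProofs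
import Literature.NumberTheory.EllipticCurves.SupersingularIrreducibleProofs
import Literature.NumberTheory.EllipticCurves.KatoRankBoundMultiplicativeProofs
import HarnessLib

/-!
# Crux K1 `SprungLowerDivisibilityAtThree` (stmt-BirchSwinnertonDyer-19875), line `chromatic-common-zeros` (skeleton v8),
# stub K_spor `stub_katoFineLowerSporadic`: the sporadic ledger ON AN X8 PAIR, in the binder shape `h714 → h716 → h3 → …`
# (`--supports` 19875 as helper; closes nothing; K_spor / K1 / leaf X8 / BSD are NOT proved here)

Cell `bsd-ssimc`, width seat `cruxlead-…-19875-w2` (g7); companion of `…KatoSporadicLedger` (the package-level ledger).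
`STUB-PLAN-stub_katoFineLowerSporadic.md` R0 asks the lead to re-key the stub as `(h714) → (h716) → (h3) → <body verbatim>`;
this file states, in exactly that shape and over the stub's own binders (X8 pair, cyclotomic/Honda setting, newform, period
ratio, Sprung pair, pinned `I` with JOINT ♯/♭ packages `Cs, Cf`, `Cs.Z = Cf.Z`), what the ledger gives:

* `ClassX8.exists_katoSporadicDefect (h714) (h716) (h3)`: ONE `j ≠ 0` in `Λ = ℤ₃⟦T⟧` (depending on the pair and the pinned
  package only) such that for EVERY fine dual datum `Y` and EVERY height-one `𝔭 ∌ 3`: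
  `ℓ_𝔭(I.H ⧸ Cs.Z) = ℓ_𝔭 Y.X + ℓ_𝔭 Λ/(j)` and `(ℓ_𝔭(I.H ⧸ Cs.Z) ≤ ℓ_𝔭 Y.X ⟺ j ∉ 𝔭)`. So the body of the (re-keyed) stub at
  `(Y, 𝔭)` — Kato's fine inequality at a sporadic common zero — says precisely «the defect `j` misses `𝔭`»; K_spor for the
  pair is «`j` has no sporadic prime factor», and K1 ∧ (Kato ⊆) off `(3)` is «`j ∈ Λˣ·3^ℕ`». Inputs: a non-vanishing colour
  (Rohrlich, `IsSprungPair.ne_zero_or_ne_zero`), its normalised `G` (period unit `h3` via `stub_periodMu`), a real dual datum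
  (`nonempty_sharpFlatSelmerDualData_rat`), f.g. torsion (`h714`), Thm. 7.16's output (`h716`), then
  `SharpFlatColemanKatoData.exists_zeta_eq_fine_add_defect`.
* `ClassX8.fine_le_zeta_le_of_chromaticL_ne_zero (h714) (h716)`: the SANDWICH `ℓ_𝔭 Y.X ≤ ℓ_𝔭(I.H ⧸ C.Z) ≤ ℓ_𝔭 Λ/(G)` off `(3)`
  for every colour with `L^• ≠ 0` and its Néron-normalised `G ≠ 0` (any package `C` of that colour).
* `ClassX8.katoFineLower_of_simpleZero`: the SIMPLE-ZERO DOOR over the stub's binders — if some non-vanishing colour has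
  `ℓ_𝔭 Λ/(G) ≤ 1` and (`ℓ_𝔭 Λ/(G) = 0` or `ℓ_𝔭 Y.X ≥ 1`), the body holds at `(Y, 𝔭)` (fact-free given `G`).

KEYING CAVEAT (STUB-PLAN §0bis): `Y` is γ-keyed as in the skeleton; no `Kato2004.thm13_4…` fact is used. HONEST FRAMING:
currency and regime logic only; the residue `{k > j}` (Kato's Main Conjecture 12.10 ⊆ at sporadic primes) is untouched.
CONDITIONAL on the displayed named facts `h714` (Sprung 2012 Thm. 7.14), `h716` (Thm. 7.16), `h3` (period unit at 3).

References: [Kato2004Asterisque] Conj. 12.10 (p. 224), Thm. 12.5 (p. 222), §17.13 (p. 280); [Sprung2012] Prop. 6.14 (p. 1498),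
Thm. 7.14, Thm. 7.16 (p. 1504), Prop. 7.19 (p. 1505); [GreenbergVatsal2000] Rem. 3.4 (period unit); tree: `…KatoSporadicLedger`,
`…StubPeriodMu` (p606253), `…KatoFineLowerIff` (p617250, the frame `K1 ⟺ KFL`).
-/

set_option linter.dupNamespace false
set_option autoImplicit false

noncomputable section

open scoped Classical NumberField MatrixGroups ModularForm

open NumberField IsDedekindDomain CongruenceSubgroup WeierstrassCurve Field
  Literature.NumberTheory.EllipticCurves Literature.NumberTheory.EllipticCurves.ModularForms
  Literature.NumberTheory.EllipticCurves.ZpExtension Literature.NumberTheory.EllipticCurves.Sprung2017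
  Literature.NumberTheory.EllipticCurves.Sprung2012 Literature.NumberTheory.EllipticCurves.Rank1Residual
  Literature.NumberTheory.EllipticCurves.Kato2004 Literature.NumberTheory.EllipticCurves.Module
  Summit.BirchSwinnertonDyer.BirchSwinnertonDyer.Theorems
  Summit.BirchSwinnertonDyer.BirchSwinnertonDyer.Theorems.SmallImageSignedMuDefect

namespace Summit.BirchSwinnertonDyer.BirchSwinnertonDyer.Theorems.ChromaticCommonZeros

/-- **THE SANDWICH `x ≤ k ≤ m^•` off `(3)` on an X8 pair, for every non-vanishing colour.** In the setting of Sprung 2012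
Thm. 2.2 on an X8 pair (`p = 3`, `a₃ = ±3`), for a colour `•` with `L^• ≠ 0`, its Néron-normalised `G ≠ 0`, ANY ♯/♭ package
`C` of colour `•` on a pinned `I`, any fine dual datum `Y` and any height-one `𝔭 ∌ 3`:
`ℓ_𝔭 Y.X ≤ ℓ_𝔭(I.H ⧸ C.Z) ≤ ℓ_𝔭 Λ/(G)`. A real dual datum of `Sel^•` is f.g. torsion by `h714` and carries Thm. 7.16's
output by `h716`. CONDITIONAL on `h714`, `h716` (displayed). [cite: Sprung2012, Thm. 7.14, Thm. 7.16 (p. 1504), Prop. 7.19 (p. 1505)]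
[cite: Kato2004Asterisque, Thm. 12.5 (p. 222), Conj. 12.10 (p. 224)] -/
theorem ClassX8.fine_le_zeta_le_of_chromaticL_ne_zero (h714 : thm714_sharpFlatSelmerDual_finite_torsion)
    (h716 : thm716_sharpFlatCharIdeal_divisibility)
    (W : WeierstrassCurve ℚ) [W.IsElliptic] [W.IsGloballyMinimal] (p : ℕ) [Fact p.Prime]
    [ContinuousSMul ℤ_[p] (W.tateModule p)] [Module.Free ℤ_[p] (W.tateModule p)]
    [Module.Finite ℤ_[p] (W.tateModule p)]
    (hX : ClassX8 W p) (κ : ZpExtension ℚ p) (γ : Field.absoluteGaloisGroup ℚ)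
    (hκ : κ.IsCyclotomic) (hγ : κ.IsTopGenerator γ) (hcv : IsCyclotomicVariable p γ)
    (v : HeightOneSpectrum (𝓞 ℚ)) (hv : (p : 𝓞 ℚ) ∈ v.asIdeal)
    (g : Field.absoluteGaloisGroup (v.adicCompletion ℚ))
    (hg : κ.IsTopGenerator (resGalOfEmb (closureEmb (K := ℚ) (v.adicCompletion ℚ)) g))
    (cneg : localPoints W (v.adicCompletion ℚ)) (c : ℕ → localPoints W (v.adicCompletion ℚ))
    (hH : IsHondaSystem κ (closureEmb (K := ℚ) (v.adicCompletion ℚ)) W (W.frobeniusTrace p) g cneg c)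
    (N : ℕ) (hN : NeZero N) (f : CuspForm (Gamma0 N) 2) (ϖ : ℚ) (Lsharp Lflat : IwasawaAlgebra p)
    (hf : IsNewformOf W f) (hSP : IsSprungPair f p (W.frobeniusTrace p) Lsharp Lflat)
    (col : Chroma) (hcol : chromaticL col Lsharp Lflat ≠ 0) (G : IwasawaAlgebra p)
    (hG : iwasawaToPowerSeries p G =
      PowerSeries.C (ϖ : ℚ_[p]) * iwasawaToPowerSeries p (chromaticL col Lsharp Lflat)) (hG0 : G ≠ 0)
    (I : Kato2004.IwasawaH1Data W p κ γ)
    (C : SharpFlatColemanKatoData W p f ϖ κ γ (closureEmb (K := ℚ) (v.adicCompletion ℚ)) (W.frobeniusTrace p) g c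
      col I)
    (Y : W.FineSelmerDualData κ γ) (𝔭 : PrimeSpectrum (IwasawaAlgebra p)) (h𝔭 : 𝔭.asIdeal.height = 1)
    (hp𝔭 : (p : IwasawaAlgebra p) ∉ 𝔭.asIdeal) :
    Module.lengthAt (IwasawaAlgebra p) Y.X 𝔭 ≤ Module.lengthAt (IwasawaAlgebra p) (I.H ⧸ C.Z) 𝔭 ∧
      Module.lengthAt (IwasawaAlgebra p) (I.H ⧸ C.Z) 𝔭 ≤
        Module.lengthAt (IwasawaAlgebra p) (IwasawaAlgebra p ⧸ Ideal.span {G}) 𝔭 := by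
  haveI : NeZero N := hN
  obtain ⟨hp3, ⟨hgood, hap⟩, -⟩ := id hX
  subst hp3
  have hp2 : (3 : ℕ) ≠ 2 := by decide
  have hirr : W.HasIrreducibleModPGaloisRep 3 :=
    hasIrreducibleModPGaloisRep_of_dvd_frobeniusTrace W 3 hp2
      (W.not_dvd_minimalDiscriminantInt_of_hasGoodReductionAtPrime' 3 hgood) hap
  obtain ⟨D⟩ := nonempty_sharpFlatSelmerDualData_rat W κ γ v g c col
  obtain ⟨hfin, hXt⟩ := h714 W 3 hp2 hgood hap f hf κ γ hκ hγ hcv v hv g hg cneg c hH col Lsharp Lflat hSP hcol D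
  haveI := hfin
  have hKato := (h716 W 3 hp2 hgood hap f hf κ γ hκ hγ hcv v hv g hg cneg c hH col Lsharp Lflat hSP hcol D hXt).1
  exact ⟨C.fine_le_zeta_of_pow_mul_mem_charIdeal W 3 hirr hSP hcol hG hG0 D hXt Y hKato 𝔭 h𝔭 hp𝔭,
    C.lengthAt_quotient_zeta_le_lengthAt_quotient_span W 3 hirr hSP hcol hG 𝔭 h𝔭⟩

/-- **THE DEFECT ELEMENT OF AN X8 PAIR** (the re-keyed stub's currency, binder shape `h714 → h716 → h3 → …`). In the setting of
Sprung 2012 Thm. 2.2 on an X8 pair, for every newform `f`, period ratio `ϖ`, Sprung pair `(L♯, L♭)`, every pinned `I` with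
JOINT ♯/♭ Coleman–Kato packages `Cs, Cf` (`Cs.Z = Cf.Z`): there is ONE `j ≠ 0` in `Λ` such that for EVERY fine dual datum `Y`
and EVERY height-one `𝔭 ∌ 3`, `ℓ_𝔭(I.H ⧸ Cs.Z) = ℓ_𝔭 Y.X + ℓ_𝔭 Λ/(j)` and (`ℓ_𝔭(I.H ⧸ Cs.Z) ≤ ℓ_𝔭 Y.X ⟺ j ∉ 𝔭`).
In particular the body of `stub_katoFineLowerSporadic` at a sporadic common zero `𝔭` holds iff `j ∉ 𝔭`: K_spor for the pair
⟺ «`j` has no sporadic prime factor». Construction: a colour `∘` with `L^∘ ≠ 0` (Prop. 6.14, Rohrlich); its normalised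
`G^∘` (period unit, `h3`); a real dual datum `D` of `Sel^∘`, f.g. torsion (`h714`); `3ⁿL^∘ ∈ char X^∘` (`h716`);
`j = 3ⁿL^∘ / gen(char X^∘)` (`exists_zeta_eq_fine_add_defect`), moved to `Cs` along `Cs.Z = Cf.Z`.
CONDITIONAL on `h714`, `h716`, `h3` (displayed). [cite: Kato2004Asterisque, Conj. 12.10 (p. 224), §17.13 (p. 280)]
[cite: Sprung2012, Prop. 6.14 (p. 1498), Thm. 7.14, Thm. 7.16 (p. 1504), Prop. 7.19 (p. 1505)] [cite: GreenbergVatsal2000, Rem. 3.4] -/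
theorem ClassX8.exists_katoSporadicDefect (h714 : thm714_sharpFlatSelmerDual_finite_torsion)
    (h716 : thm716_sharpFlatCharIdeal_divisibility) (h3 : realPeriodRat_eq_unit_mul_plusPeriod_three)
    (W : WeierstrassCurve ℚ) [W.IsElliptic] [W.IsGloballyMinimal] (p : ℕ) [Fact p.Prime]
    [ContinuousSMul ℤ_[p] (W.tateModule p)] [Module.Free ℤ_[p] (W.tateModule p)]
    [Module.Finite ℤ_[p] (W.tateModule p)]
    (hX : ClassX8 W p) (κ : ZpExtension ℚ p) (γ : Field.absoluteGaloisGroup ℚ)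
    (hκ : κ.IsCyclotomic) (hγ : κ.IsTopGenerator γ) (hcv : IsCyclotomicVariable p γ)
    (v : HeightOneSpectrum (𝓞 ℚ)) (hv : (p : 𝓞 ℚ) ∈ v.asIdeal)
    (g : Field.absoluteGaloisGroup (v.adicCompletion ℚ))
    (hg : κ.IsTopGenerator (resGalOfEmb (closureEmb (K := ℚ) (v.adicCompletion ℚ)) g))
    (cneg : localPoints W (v.adicCompletion ℚ)) (c : ℕ → localPoints W (v.adicCompletion ℚ))
    (hH : IsHondaSystem κ (closureEmb (K := ℚ) (v.adicCompletion ℚ)) W (W.frobeniusTrace p) g cneg c)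
    (N : ℕ) (hN : NeZero N) (f : CuspForm (Gamma0 N) 2) (ϖ : ℚ) (Lsharp Lflat : IwasawaAlgebra p)
    (hf : IsNewformOf W f) (hϖ : (ϖ : ℝ) * W.realPeriodRat = plusPeriod f)
    (hSP : IsSprungPair f p (W.frobeniusTrace p) Lsharp Lflat)
    (I : Kato2004.IwasawaH1Data W p κ γ)
    (Cs : SharpFlatColemanKatoData W p f ϖ κ γ (closureEmb (K := ℚ) (v.adicCompletion ℚ)) (W.frobeniusTrace p) g c
      Chroma.sharp I)
    (Cf : SharpFlatColemanKatoData W p f ϖ κ γ (closureEmb (K := ℚ) (v.adicCompletion ℚ)) (W.frobeniusTrace p) g c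
      Chroma.flat I)
    (hZ : Cs.Z = Cf.Z) :
    ∃ j : IwasawaAlgebra p, j ≠ 0 ∧
      ∀ (Y : W.FineSelmerDualData κ γ) (𝔭 : PrimeSpectrum (IwasawaAlgebra p)), 𝔭.asIdeal.height = 1 →
        (p : IwasawaAlgebra p) ∉ 𝔭.asIdeal →
        Module.lengthAt (IwasawaAlgebra p) (I.H ⧸ Cs.Z) 𝔭 =
            Module.lengthAt (IwasawaAlgebra p) Y.X 𝔭 +
              Module.lengthAt (IwasawaAlgebra p) (IwasawaAlgebra p ⧸ Ideal.span {j}) 𝔭 ∧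
          (Module.lengthAt (IwasawaAlgebra p) (I.H ⧸ Cs.Z) 𝔭 ≤ Module.lengthAt (IwasawaAlgebra p) Y.X 𝔭 ↔
            j ∉ 𝔭.asIdeal) := by
  haveI : NeZero N := hN
  obtain ⟨hp3, ⟨hgood, hap⟩, -⟩ := id hX
  subst hp3
  have hp2 : (3 : ℕ) ≠ 2 := by decide
  have hirr : W.HasIrreducibleModPGaloisRep 3 :=
    hasIrreducibleModPGaloisRep_of_dvd_frobeniusTrace W 3 hp2
      (W.not_dvd_minimalDiscriminantInt_of_hasGoodReductionAtPrime' 3 hgood) hap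
  have hϖ0 : ϖ ≠ 0 := hf.periodRatio_ne_zero hϖ
  obtain ⟨hGall, -⟩ := stub_periodMu h3 W 3 hX N hN f ϖ Lsharp Lflat hf hϖ hSP
  -- the defect of ANY non-vanishing colour `∘`, for ANY package of that colour on `I`
  have key : ∀ (c₀ : Chroma), chromaticL c₀ Lsharp Lflat ≠ 0 →
      ∀ (C : SharpFlatColemanKatoData W 3 f ϖ κ γ (closureEmb (K := ℚ) (v.adicCompletion ℚ))
        (W.frobeniusTrace 3) g c c₀ I),
      ∃ j : IwasawaAlgebra 3, j ≠ 0 ∧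
        ∀ (Y : W.FineSelmerDualData κ γ) (𝔭 : PrimeSpectrum (IwasawaAlgebra 3)), 𝔭.asIdeal.height = 1 →
          ((3 : ℕ) : IwasawaAlgebra 3) ∉ 𝔭.asIdeal →
          Module.lengthAt (IwasawaAlgebra 3) (I.H ⧸ C.Z) 𝔭 =
              Module.lengthAt (IwasawaAlgebra 3) Y.X 𝔭 +
                Module.lengthAt (IwasawaAlgebra 3) (IwasawaAlgebra 3 ⧸ Ideal.span {j}) 𝔭 ∧
            (Module.lengthAt (IwasawaAlgebra 3) (I.H ⧸ C.Z) 𝔭 ≤ Module.lengthAt (IwasawaAlgebra 3) Y.X 𝔭 ↔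
              j ∉ 𝔭.asIdeal) := by
    intro c₀ hc₀ C
    obtain ⟨G, hG⟩ := hGall c₀
    have hG0 : G ≠ 0 := by
      intro h0
      rw [h0, map_zero, eq_comm, mul_eq_zero] at hG
      rcases hG with hC | hL
      · have h1 : ((ϖ : ℚ) : ℚ_[3]) = 0 := by simpa using congrArg PowerSeries.constantCoeff hC
        exact hϖ0 (by exact_mod_cast h1)
      · exact hc₀ (iwasawaToPowerSeries_injective 3 (by rw [hL, map_zero]))
    obtain ⟨D⟩ := nonempty_sharpFlatSelmerDualData_rat W κ γ v g c c₀
    obtain ⟨hfin, hXt⟩ := h714 W 3 hp2 hgood hap f hf κ γ hκ hγ hcv v hv g hg cneg c hH c₀ Lsharp Lflat hSP hc₀ D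
    haveI := hfin
    have hKato := (h716 W 3 hp2 hgood hap f hf κ γ hκ hγ hcv v hv g hg cneg c hH c₀ Lsharp Lflat hSP hc₀ D hXt).1
    obtain ⟨j, hj0, hj⟩ := C.exists_zeta_eq_fine_add_defect W 3 hirr hSP hc₀ hG hG0 D hXt hKato
    refine ⟨j, hj0, fun Y 𝔭 h𝔭 hp𝔭 => ⟨hj Y 𝔭 h𝔭 hp𝔭, ?_⟩⟩
    have hk : Module.lengthAt (IwasawaAlgebra 3) (I.H ⧸ C.Z) 𝔭 ≠ ⊤ :=
      C.lengthAt_quotient_zeta_ne_top W 3 hirr hSP hc₀ hG hG0 𝔭 h𝔭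
    exact zeta_le_fine_iff_not_mem_of_eq_add hk 𝔭 (hj Y 𝔭 h𝔭 hp𝔭)
  rcases IsSprungPair.ne_zero_or_ne_zero hf hgood hSP with hs | hfl
  · exact key Chroma.sharp hs Cs
  · rw [hZ]; exact key Chroma.flat hfl Cf

/-- **THE SIMPLE-ZERO DOOR over the stub's binders** (fact-free given the normalised function). On an X8 pair, for a pinned
`I` with a package `C` of a colour `•` with `L^• ≠ 0` and Néron-normalised `G`, a fine dual datum `Y` and a height-one `𝔭`:
if `ℓ_𝔭 Λ/(G) ≤ 1` (at most a simple zero of `L^•` at `𝔭`) and (`ℓ_𝔭 Λ/(G) = 0` or `ℓ_𝔭 Y.X ≥ 1`), then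
`ℓ_𝔭(I.H ⧸ C.Z) ≤ ℓ_𝔭 Y.X` — the body of `stub_katoFineLowerSporadic` at `(Y, 𝔭)` for `C = Cs`. At a simple sporadic common
zero, K_spor IS the support statement `ℓ_𝔭 Y.X ≥ 1`. [cite: Kato2004Asterisque, Conj. 12.10 (p. 224)]
[cite: Sprung2012, Thm. 7.14 (3) (p. 1504)] -/
theorem ClassX8.katoFineLower_of_simpleZero
    (W : WeierstrassCurve ℚ) [W.IsElliptic] [W.IsGloballyMinimal] (p : ℕ) [Fact p.Prime]
    [ContinuousSMul ℤ_[p] (W.tateModule p)] [Module.Free ℤ_[p] (W.tateModule p)]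
    [Module.Finite ℤ_[p] (W.tateModule p)]
    (hX : ClassX8 W p) (κ : ZpExtension ℚ p) (γ : Field.absoluteGaloisGroup ℚ)
    (v : HeightOneSpectrum (𝓞 ℚ)) (g : Field.absoluteGaloisGroup (v.adicCompletion ℚ))
    (c : ℕ → localPoints W (v.adicCompletion ℚ))
    (N : ℕ) (f : CuspForm (Gamma0 N) 2) (ϖ : ℚ) (Lsharp Lflat : IwasawaAlgebra p)
    (hSP : IsSprungPair f p (W.frobeniusTrace p) Lsharp Lflat)
    (col : Chroma) (hcol : chromaticL col Lsharp Lflat ≠ 0) (G : IwasawaAlgebra p)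
    (hG : iwasawaToPowerSeries p G =
      PowerSeries.C (ϖ : ℚ_[p]) * iwasawaToPowerSeries p (chromaticL col Lsharp Lflat))
    (I : Kato2004.IwasawaH1Data W p κ γ)
    (C : SharpFlatColemanKatoData W p f ϖ κ γ (closureEmb (K := ℚ) (v.adicCompletion ℚ)) (W.frobeniusTrace p) g c
      col I)
    (Y : W.FineSelmerDualData κ γ) (𝔭 : PrimeSpectrum (IwasawaAlgebra p)) (h𝔭 : 𝔭.asIdeal.height = 1)
    (hsimple : Module.lengthAt (IwasawaAlgebra p) (IwasawaAlgebra p ⧸ Ideal.span {G}) 𝔭 ≤ 1)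
    (hsupp : Module.lengthAt (IwasawaAlgebra p) (IwasawaAlgebra p ⧸ Ideal.span {G}) 𝔭 = 0 ∨
      1 ≤ Module.lengthAt (IwasawaAlgebra p) Y.X 𝔭) :
    Module.lengthAt (IwasawaAlgebra p) (I.H ⧸ C.Z) 𝔭 ≤ Module.lengthAt (IwasawaAlgebra p) Y.X 𝔭 := by
  obtain ⟨hp3, ⟨hgood, hap⟩, -⟩ := id hX
  subst hp3
  have hp2 : (3 : ℕ) ≠ 2 := by decide
  have hirr : W.HasIrreducibleModPGaloisRep 3 :=
    hasIrreducibleModPGaloisRep_of_dvd_frobeniusTrace W 3 hp2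
      (W.not_dvd_minimalDiscriminantInt_of_hasGoodReductionAtPrime' 3 hgood) hap
  exact C.fine_lower_of_lengthAt_quotient_span_le_one W 3 hirr hSP hcol hG Y 𝔭 h𝔭 hsimple hsupp

end Summit.BirchSwinnertonDyer.BirchSwinnertonDyer.Theorems.ChromaticCommonZeros

end
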